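import Summits.KontsevichZagierPeriods.KontsevichZagierPeriods.Theorems.AbelContractionRealHyperellipticSectorDefs
import Summits.KontsevichZagierPeriods.KontsevichZagierPeriods.Theorems.AbelContractionRealHyperellipticSectorBudgetKit
import Summits.KontsevichZagierPeriods.KontsevichZagierPeriods.Theorems.HurwitzMicroSectorsNormalFormPrincipleAlgSplitK5Kit
import Summits.KontsevichZagierPeriods.KontsevichZagierPeriods.Theorems.HermiteRigidityGenusTwoCycleTransferPushforwardDimOne

/-!
# Route AbelContraction — `RealHyperellipticSector` (crux stmt-KontsevichZagierPeriods-12475): the Euler kit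

Helper file of the line `Lines/birth.lean` (stub `stub_euler`, `--supports` the crux): the
bookkeeping behind Euler's substitutions inside dimension one. The target of the stub is the set
`algArcs` of REAL-ALGEBRAIC RATIONAL ARCS `[T, P/Q]` (`T ⊆ ℝ` an open interval, `P, Q ∈ K[X]`,
`K = algebraicClosure ℚ ℝ` the real algebraic numbers, `Q ≠ 0` on `T`). Contents:

* the closure properties of *`K`-rational functions on a set `T ⊆ ℝ`* — real functions equal on
  `T` to a quotient `P/Q`, `P Q ∈ K[X]`, `Q ≠ 0` on `T` — under constants in `K`, the coordinate,
  `+`, `−`, `*`, `⁻¹`, `/`, powers and substitution into a `ℚ`-polynomial (`Euler.krat_*`; the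
  predicate is kept INLINE as `∃ P Q, ∀ t ∈ T, Q(t) ≠ 0 ∧ f t = P(t)/Q(t)`, no definition is
  introduced);
* `Euler.of_mem_algArcs`: a representation over a slab `{p | p 0 ∈ S}` whose integrand is a
  `K`-rational function of the coordinate on `S` is a real-algebraic rational arc;
* `Euler.isOpen_image_of_injOn`, `Euler.ordConnected_image`: the image of an open interval under
  a map continuous and injective on it is an open interval (strict monotonicity of continuous
  injective maps, intermediate values, connectedness);
* the registered sub-goal `Euler.exists_algArc_of_subst`: **one rule-(2) move to a real-algebraic
  rational arc** — if `φ` is `ℚ`-semialgebraic on the slab of `S` with `ℚ`-semialgebraic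
  nowhere-zero derivative `φ'` on `S`, `ψ` is a `K`-rational inverse of `φ` on `T = φ(S)`, and the
  pushed-forward integrand is `K`-rational on `T` (`f(x)/|φ'(x)| = F(φ x)`, `F` `K`-rational), then
  `[r] − [T, F] ∈ KZ.relationsLE 1`: the push-forward `stub_pushforwardDimOne` (tree,
  `HermiteRigidityGenusTwoCycleTransferPushforwardDimOne`) supplies the `KZ.changeOfVariablesRel`
  instance (integrability by
  `MeasureTheory.integrableOn_image_iff_integrableOn_abs_det_fderiv_smul`, semialgebraicity of
  the image by Tarski–Seidenberg), which lies in `KZ.movesLE 1` as both representations have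
  dimension `1`.

References: M. Kontsevich, D. Zagier, *Periods* (2001), §1.1 ("rational" may be replaced by
"algebraic"), §1.2 rule (2) [KontsevichZagier2001]; J. Bochnak, M. Coste, M.-F. Roy, *Real
Algebraic Geometry* (1998), §2.2 (Prop. 2.2.6–2.2.7) [BochnakCosteRoy1998]. No definitions are
introduced.
-/

noncomputable section

open Set MeasureTheory
open scoped Polynomial
open Literature.ModelTheory.ExponentialFields (IsSemialgebraic)
open Literature.NumberTheory.Transcendental Literature.NumberTheory.Transcendental.KZ
open Summit.KontsevichZagierPeriods.HurwitzMicroSectors.NormalFormPrinciple.PiBox.AlgSplitK5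
  (isSemialgebraicFunOn_aevalK_div)
open Summit.KontsevichZagierPeriods.HermiteRigidity.GenusTwoCycleTransfer (stub_pushforwardDimOne)

namespace Summit.KontsevichZagierPeriods.AbelContraction.RealHyperellipticSector

namespace Euler

variable {T T' : Set ℝ} {f g : ℝ → ℝ}

/-! ## `K`-rational functions on a set of reals (`K = algebraicClosure ℚ ℝ`)

A real function `f` is *`K`-rational on `T ⊆ ℝ`* if `f = P/Q` on `T` for some `P Q ∈ K[X]` with
`Q ≠ 0` on `T`; this is the shape of the integrands of `algArcs`. The predicate is kept inline
(`∃ P Q, ∀ t ∈ T, Q(t) ≠ 0 ∧ f t = P(t)/Q(t)`); no definition is introduced. -/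

/-- A real algebraic constant is `K`-rational. [folklore] -/
theorem krat_const (T : Set ℝ) {c : ℝ} (hc : IsAlgebraic ℚ c) :
    ∃ P Q : (algebraicClosure ℚ ℝ)[X], ∀ t ∈ T, (Polynomial.aeval t Q : ℝ) ≠ 0 ∧
      (fun _ : ℝ => c) t = (Polynomial.aeval t P : ℝ) / (Polynomial.aeval t Q : ℝ) := by
  refine ⟨Polynomial.C ⟨c, mem_algebraicClosure_iff.mpr hc⟩, 1, fun t _ => ⟨by simp, ?_⟩⟩
  simp only [Polynomial.aeval_C, map_one, div_one]
  rfl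

/-- The coordinate is `K`-rational. [folklore] -/
theorem krat_id (T : Set ℝ) :
    ∃ P Q : (algebraicClosure ℚ ℝ)[X], ∀ t ∈ T, (Polynomial.aeval t Q : ℝ) ≠ 0 ∧
      (fun s : ℝ => s) t = (Polynomial.aeval t P : ℝ) / (Polynomial.aeval t Q : ℝ) :=
  ⟨Polynomial.X, 1, fun t _ => ⟨by simp, by simp⟩⟩

/-- `K`-rationality only depends on the values on `T`. [folklore] -/
theorem krat_congr
    (hf : ∃ P Q : (algebraicClosure ℚ ℝ)[X], ∀ t ∈ T, (Polynomial.aeval t Q : ℝ) ≠ 0 ∧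
      f t = (Polynomial.aeval t P : ℝ) / (Polynomial.aeval t Q : ℝ))
    (h : ∀ t ∈ T, f t = g t) :
    ∃ P Q : (algebraicClosure ℚ ℝ)[X], ∀ t ∈ T, (Polynomial.aeval t Q : ℝ) ≠ 0 ∧
      g t = (Polynomial.aeval t P : ℝ) / (Polynomial.aeval t Q : ℝ) := by
  obtain ⟨P, Q, hPQ⟩ := hf
  exact ⟨P, Q, fun t ht => ⟨(hPQ t ht).1, (h t ht) ▸ (hPQ t ht).2⟩⟩

/-- `K`-rationality restricts to subsets. [folklore] -/
theorem krat_mono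
    (hf : ∃ P Q : (algebraicClosure ℚ ℝ)[X], ∀ t ∈ T, (Polynomial.aeval t Q : ℝ) ≠ 0 ∧
      f t = (Polynomial.aeval t P : ℝ) / (Polynomial.aeval t Q : ℝ))
    (h : T' ⊆ T) :
    ∃ P Q : (algebraicClosure ℚ ℝ)[X], ∀ t ∈ T', (Polynomial.aeval t Q : ℝ) ≠ 0 ∧
      f t = (Polynomial.aeval t P : ℝ) / (Polynomial.aeval t Q : ℝ) := by
  obtain ⟨P, Q, hPQ⟩ := hf
  exact ⟨P, Q, fun t ht => hPQ t (h ht)⟩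

/-- Sums of `K`-rational functions are `K`-rational. [folklore] -/
theorem krat_add
    (hf : ∃ P Q : (algebraicClosure ℚ ℝ)[X], ∀ t ∈ T, (Polynomial.aeval t Q : ℝ) ≠ 0 ∧
      f t = (Polynomial.aeval t P : ℝ) / (Polynomial.aeval t Q : ℝ))
    (hg : ∃ P Q : (algebraicClosure ℚ ℝ)[X], ∀ t ∈ T, (Polynomial.aeval t Q : ℝ) ≠ 0 ∧
      g t = (Polynomial.aeval t P : ℝ) / (Polynomial.aeval t Q : ℝ)) :
    ∃ P Q : (algebraicClosure ℚ ℝ)[X], ∀ t ∈ T, (Polynomial.aeval t Q : ℝ) ≠ 0 ∧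
      (fun s => f s + g s) t = (Polynomial.aeval t P : ℝ) / (Polynomial.aeval t Q : ℝ) := by
  obtain ⟨P₁, Q₁, h₁⟩ := hf
  obtain ⟨P₂, Q₂, h₂⟩ := hg
  refine ⟨P₁ * Q₂ + P₂ * Q₁, Q₁ * Q₂, fun t ht => ?_⟩
  obtain ⟨hq₁, hf₁⟩ := h₁ t ht
  obtain ⟨hq₂, hf₂⟩ := h₂ t ht
  refine ⟨by simpa [map_mul] using mul_ne_zero hq₁ hq₂, ?_⟩
  simp only [map_add, map_mul, hf₁, hf₂]
  field_simp

/-- Products of `K`-rational functions are `K`-rational. [folklore] -/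
theorem krat_mul
    (hf : ∃ P Q : (algebraicClosure ℚ ℝ)[X], ∀ t ∈ T, (Polynomial.aeval t Q : ℝ) ≠ 0 ∧
      f t = (Polynomial.aeval t P : ℝ) / (Polynomial.aeval t Q : ℝ))
    (hg : ∃ P Q : (algebraicClosure ℚ ℝ)[X], ∀ t ∈ T, (Polynomial.aeval t Q : ℝ) ≠ 0 ∧
      g t = (Polynomial.aeval t P : ℝ) / (Polynomial.aeval t Q : ℝ)) :
    ∃ P Q : (algebraicClosure ℚ ℝ)[X], ∀ t ∈ T, (Polynomial.aeval t Q : ℝ) ≠ 0 ∧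
      (fun s => f s * g s) t = (Polynomial.aeval t P : ℝ) / (Polynomial.aeval t Q : ℝ) := by
  obtain ⟨P₁, Q₁, h₁⟩ := hf
  obtain ⟨P₂, Q₂, h₂⟩ := hg
  refine ⟨P₁ * P₂, Q₁ * Q₂, fun t ht => ?_⟩
  obtain ⟨hq₁, hf₁⟩ := h₁ t ht
  obtain ⟨hq₂, hf₂⟩ := h₂ t ht
  refine ⟨by simpa [map_mul] using mul_ne_zero hq₁ hq₂, ?_⟩
  simp only [map_mul, hf₁, hf₂]
  field_simp

/-- Inverses of non-vanishing `K`-rational functions are `K`-rational. [folklore] -/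
theorem krat_inv
    (hf : ∃ P Q : (algebraicClosure ℚ ℝ)[X], ∀ t ∈ T, (Polynomial.aeval t Q : ℝ) ≠ 0 ∧
      f t = (Polynomial.aeval t P : ℝ) / (Polynomial.aeval t Q : ℝ))
    (h0 : ∀ t ∈ T, f t ≠ 0) :
    ∃ P Q : (algebraicClosure ℚ ℝ)[X], ∀ t ∈ T, (Polynomial.aeval t Q : ℝ) ≠ 0 ∧
      (fun s => (f s)⁻¹) t = (Polynomial.aeval t P : ℝ) / (Polynomial.aeval t Q : ℝ) := by
  obtain ⟨P, Q, hPQ⟩ := hf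
  refine ⟨Q, P, fun t ht => ?_⟩
  obtain ⟨hq, hft⟩ := hPQ t ht
  have hp : (Polynomial.aeval t P : ℝ) ≠ 0 := by
    intro hp
    exact h0 t ht (by rw [hft, hp, zero_div])
  exact ⟨hp, by show (f t)⁻¹ = _; rw [hft, inv_div]⟩

/-- Quotients of `K`-rational functions (denominator non-vanishing) are `K`-rational. [folklore] -/
theorem krat_div
    (hf : ∃ P Q : (algebraicClosure ℚ ℝ)[X], ∀ t ∈ T, (Polynomial.aeval t Q : ℝ) ≠ 0 ∧
      f t = (Polynomial.aeval t P : ℝ) / (Polynomial.aeval t Q : ℝ))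
    (hg : ∃ P Q : (algebraicClosure ℚ ℝ)[X], ∀ t ∈ T, (Polynomial.aeval t Q : ℝ) ≠ 0 ∧
      g t = (Polynomial.aeval t P : ℝ) / (Polynomial.aeval t Q : ℝ))
    (h0 : ∀ t ∈ T, g t ≠ 0) :
    ∃ P Q : (algebraicClosure ℚ ℝ)[X], ∀ t ∈ T, (Polynomial.aeval t Q : ℝ) ≠ 0 ∧
      (fun s => f s / g s) t = (Polynomial.aeval t P : ℝ) / (Polynomial.aeval t Q : ℝ) :=
  krat_congr (krat_mul hf (krat_inv hg h0)) fun t _ => by simp [div_eq_mul_inv]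

/-- Negatives of `K`-rational functions are `K`-rational. [folklore] -/
theorem krat_neg
    (hf : ∃ P Q : (algebraicClosure ℚ ℝ)[X], ∀ t ∈ T, (Polynomial.aeval t Q : ℝ) ≠ 0 ∧
      f t = (Polynomial.aeval t P : ℝ) / (Polynomial.aeval t Q : ℝ)) :
    ∃ P Q : (algebraicClosure ℚ ℝ)[X], ∀ t ∈ T, (Polynomial.aeval t Q : ℝ) ≠ 0 ∧
      (fun s => -f s) t = (Polynomial.aeval t P : ℝ) / (Polynomial.aeval t Q : ℝ) :=
  krat_congr (krat_mul (krat_const T (isAlgebraic_one.neg : IsAlgebraic ℚ (-1 : ℝ))) hf)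
    fun t _ => by simp

/-- Differences of `K`-rational functions are `K`-rational. [folklore] -/
theorem krat_sub
    (hf : ∃ P Q : (algebraicClosure ℚ ℝ)[X], ∀ t ∈ T, (Polynomial.aeval t Q : ℝ) ≠ 0 ∧
      f t = (Polynomial.aeval t P : ℝ) / (Polynomial.aeval t Q : ℝ))
    (hg : ∃ P Q : (algebraicClosure ℚ ℝ)[X], ∀ t ∈ T, (Polynomial.aeval t Q : ℝ) ≠ 0 ∧
      g t = (Polynomial.aeval t P : ℝ) / (Polynomial.aeval t Q : ℝ)) :
    ∃ P Q : (algebraicClosure ℚ ℝ)[X], ∀ t ∈ T, (Polynomial.aeval t Q : ℝ) ≠ 0 ∧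
      (fun s => f s - g s) t = (Polynomial.aeval t P : ℝ) / (Polynomial.aeval t Q : ℝ) :=
  krat_congr (krat_add hf (krat_neg hg)) fun t _ => by simp [sub_eq_add_neg]

/-- Powers of `K`-rational functions are `K`-rational. [folklore] -/
theorem krat_pow
    (hf : ∃ P Q : (algebraicClosure ℚ ℝ)[X], ∀ t ∈ T, (Polynomial.aeval t Q : ℝ) ≠ 0 ∧
      f t = (Polynomial.aeval t P : ℝ) / (Polynomial.aeval t Q : ℝ)) (n : ℕ) :
    ∃ P Q : (algebraicClosure ℚ ℝ)[X], ∀ t ∈ T, (Polynomial.aeval t Q : ℝ) ≠ 0 ∧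
      (fun s => f s ^ n) t = (Polynomial.aeval t P : ℝ) / (Polynomial.aeval t Q : ℝ) := by
  induction n with
  | zero => exact krat_congr (krat_const T isAlgebraic_one) fun t _ => by simp
  | succ n ih => exact krat_congr (krat_mul ih hf) fun t _ => by simp [pow_succ]

/-- A `ℚ`-polynomial of a `K`-rational function is `K`-rational. [folklore] -/
theorem krat_aeval (A : ℚ[X])
    (hf : ∃ P Q : (algebraicClosure ℚ ℝ)[X], ∀ t ∈ T, (Polynomial.aeval t Q : ℝ) ≠ 0 ∧
      f t = (Polynomial.aeval t P : ℝ) / (Polynomial.aeval t Q : ℝ)) :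
    ∃ P Q : (algebraicClosure ℚ ℝ)[X], ∀ t ∈ T, (Polynomial.aeval t Q : ℝ) ≠ 0 ∧
      (fun s => (Polynomial.aeval (f s) A : ℝ)) t =
        (Polynomial.aeval t P : ℝ) / (Polynomial.aeval t Q : ℝ) := by
  induction A using Polynomial.induction_on' with
  | add p q hp hq => exact krat_congr (krat_add hp hq) fun t _ => by simp
  | monomial n a =>
    refine krat_congr (krat_mul (krat_const T (isAlgebraic_algebraMap (R := ℚ) (A := ℝ) a))
      (krat_pow hf n)) fun t _ => ?_
    simp [Polynomial.aeval_monomial]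

/-! ## A small algebraic fact -/

/-- The real square root of a real algebraic number is algebraic. [folklore] -/
theorem isAlgebraic_sqrt {a : ℝ} (ha : IsAlgebraic ℚ a) : IsAlgebraic ℚ (√a) := by
  by_cases h : 0 ≤ a
  · exact IsAlgebraic.of_pow two_pos (by rwa [Real.sq_sqrt h])
  · rw [Real.sqrt_eq_zero'.mpr (not_le.mp h).le]
    exact isAlgebraic_zero

/-! ## Real-algebraic rational arcs from `K`-rational integrands -/

/-- A one-dimensional representation over a slab `{p | p 0 ∈ S}` (`S` open, order-connected) whose
integrand is, on the domain, a `K`-rational function of the coordinate is a real-algebraic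
rational arc. [cite: KontsevichZagier2001, §1.1] -/
theorem of_mem_algArcs (N : IntegralRep 1) (S : Set ℝ) (hS : IsOpen S) (hSo : S.OrdConnected)
    (hdom : N.domain = {p | p 0 ∈ S}) (F : ℝ → ℝ)
    (hF : ∃ P Q : (algebraicClosure ℚ ℝ)[X], ∀ t ∈ S, (Polynomial.aeval t Q : ℝ) ≠ 0 ∧
      F t = (Polynomial.aeval t P : ℝ) / (Polynomial.aeval t Q : ℝ))
    (hint : ∀ p ∈ N.domain, N.integrand p = F (p 0)) : of N ∈ algArcs := by
  obtain ⟨P, Q, hPQ⟩ := hF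
  have hmem : ∀ p, p ∈ N.domain ↔ p 0 ∈ S := fun p => by rw [hdom]; rfl
  exact ⟨N, P, Q, S, hS, hSo, hdom, fun p hp => (hPQ _ ((hmem p).1 hp)).1,
    fun p hp => by rw [hint p hp]; exact (hPQ _ ((hmem p).1 hp)).2, rfl⟩

/-! ## Images of open intervals under continuous injective maps -/

/-- The image of an open subset of `ℝ` under a map continuous and injective on it is open
(continuous injective maps of an interval are strictly monotone; intermediate values). [folklore] -/
theorem isOpen_image_of_injOn {S : Set ℝ} (hS : IsOpen S) {φ : ℝ → ℝ} (hc : ContinuousOn φ S)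
    (hinj : InjOn φ S) : IsOpen (φ '' S) := by
  rw [isOpen_iff_mem_nhds]
  rintro _ ⟨x, hx, rfl⟩
  obtain ⟨ε, hε, hball⟩ := Metric.isOpen_iff.mp hS x hx
  have hI : Icc (x - ε / 2) (x + ε / 2) ⊆ S := fun y hy => hball (by
    rw [Metric.mem_ball, Real.dist_eq, abs_lt]
    constructor <;> linarith [hy.1, hy.2])
  have hcI : ContinuousOn φ (Icc (x - ε / 2) (x + ε / 2)) := hc.mono hI
  have hiI : InjOn φ (Icc (x - ε / 2) (x + ε / 2)) := hinj.mono hI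
  have hxε : x - ε / 2 ≤ x + ε / 2 := by linarith
  have hl : x - ε / 2 ∈ Icc (x - ε / 2) (x + ε / 2) := left_mem_Icc.2 hxε
  have hr : x + ε / 2 ∈ Icc (x - ε / 2) (x + ε / 2) := right_mem_Icc.2 hxε
  have hxI : x ∈ Icc (x - ε / 2) (x + ε / 2) := ⟨by linarith, by linarith⟩
  rcases hcI.strictMonoOn_of_injOn_Icc' hxε hiI with hmono | hanti
  · have h1 : φ (x - ε / 2) < φ x := hmono hl hxI (by linarith)
    have h2 : φ x < φ (x + ε / 2) := hmono hxI hr (by linarith)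
    refine Filter.mem_of_superset (Ioo_mem_nhds h1 h2) fun y hy => ?_
    obtain ⟨z, hz, rfl⟩ := intermediate_value_Icc hxε hcI ⟨hy.1.le, hy.2.le⟩
    exact ⟨z, hI hz, rfl⟩
  · have h1 : φ x < φ (x - ε / 2) := hanti hl hxI (by linarith)
    have h2 : φ (x + ε / 2) < φ x := hanti hxI hr (by linarith)
    refine Filter.mem_of_superset (Ioo_mem_nhds h2 h1) fun y hy => ?_
    obtain ⟨z, hz, rfl⟩ := intermediate_value_Icc' hxε hcI ⟨hy.1.le, hy.2.le⟩
    exact ⟨z, hI hz, rfl⟩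

/-- The image of an order-connected subset of `ℝ` under a map continuous on it is
order-connected (connectedness). [folklore] -/
theorem ordConnected_image {S : Set ℝ} (hSo : S.OrdConnected) {φ : ℝ → ℝ}
    (hc : ContinuousOn φ S) : (φ '' S).OrdConnected :=
  isPreconnected_iff_ordConnected.mp ((isPreconnected_iff_ordConnected.mpr hSo).image φ hc)

/-! ## One rule-(2) move to a real-algebraic rational arc -/

/-- **Substitution to a real-algebraic rational arc (one move of rule (2) inside dimension one).**
Let `r` be a one-dimensional representation over the slab of an open order-connected `S ⊆ ℝ`,
`φ` a `ℚ`-semialgebraic function of the coordinate with `ℚ`-semialgebraic nowhere-zero derivative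
`φ'` on `S` and a `K`-rational inverse `ψ` on `T = φ(S)`, and suppose the pushed-forward integrand
`(f/|φ'|) ∘ ψ` is `K`-rational on `T`: `f(x)/|φ'(x)| = F(φ x)` with `F` `K`-rational on `T`. Then
`[r] − [s] ∈ KZ.relationsLE 1` for the real-algebraic rational arc `s = [T, F]`
(`stub_pushforwardDimOne`; `T` is open and order-connected as the continuous injective image of
`S`). [cite: KontsevichZagier2001, §1.2 rule (2)] -/
theorem exists_algArc_of_subst : ∀ (r : KZ.IntegralRep 1) (S : Set ℝ), IsOpen S → S.OrdConnected →
    r.domain = {p | p 0 ∈ S} → ∀ (φ φ' ψ F : ℝ → ℝ),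
    IsSemialgebraicFunOn ℚ r.domain (fun p => φ (p 0)) →
    IsSemialgebraicFunOn ℚ r.domain (fun p => φ' (p 0)) →
    (∀ x ∈ S, HasDerivAt φ (φ' x) x) → (∀ x ∈ S, φ' x ≠ 0) →
    (∃ P Q : Polynomial (algebraicClosure ℚ ℝ), ∀ t ∈ φ '' S, (Polynomial.aeval t Q : ℝ) ≠ 0 ∧
      ψ t = (Polynomial.aeval t P : ℝ) / (Polynomial.aeval t Q : ℝ)) →
    (∀ x ∈ S, ψ (φ x) = x) →
    (∃ P Q : Polynomial (algebraicClosure ℚ ℝ), ∀ t ∈ φ '' S, (Polynomial.aeval t Q : ℝ) ≠ 0 ∧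
      F t = (Polynomial.aeval t P : ℝ) / (Polynomial.aeval t Q : ℝ)) →
    (∀ p ∈ r.domain, r.integrand p / |φ' (p 0)| = F (φ (p 0))) →
    ∃ x' ∈ algArcs, KZ.of r - x' ∈ KZ.relationsLE 1 := by
  intro r S hS hSo hdom φ φ' ψ F hφ hφ' hder hne hψ hψφ hF hFφ
  have hmem : ∀ p, p ∈ r.domain ↔ p 0 ∈ S := fun p => by rw [hdom]; rfl
  have heq : ∀ p : Fin 1 → ℝ, (fun _ : Fin 1 => p 0) = p := fun p => by
    funext i
    rw [Fin.fin_one_eq_zero i]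
  -- the image slab
  have himg : (fun p : Fin 1 → ℝ => fun _ : Fin 1 => φ (p 0)) '' r.domain =
      {p | p 0 ∈ φ '' S} := by
    ext p'
    simp only [mem_image, mem_setOf_eq]
    constructor
    · rintro ⟨p, hp, rfl⟩
      exact ⟨p 0, (hmem p).1 hp, rfl⟩
    · rintro ⟨x, hx, hx'⟩
      refine ⟨fun _ => x, (hmem _).2 hx, ?_⟩
      rw [← heq p']
      funext i
      exact hx'
  have hΦsa : IsSemialgebraicMapOn ℚ r.domain (fun p : Fin 1 → ℝ => fun _ : Fin 1 => φ (p 0)) :=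
    IsSemialgebraicMapOn.of_forall r.isSemialgebraic_domain fun _ => hφ
  have hT : IsSemialgebraic ℚ {p : Fin 1 → ℝ | p 0 ∈ φ '' S} := by
    have h := IsSemialgebraicMapOn.isSemialgebraic_image_holds hΦsa subset_rfl
      r.isSemialgebraic_domain
    rwa [himg] at h
  -- the inverse chart
  obtain ⟨Pψ, Qψ, hPQψ⟩ := hψ
  have hG : IsSemialgebraicMapOn ℚ ((fun p : Fin 1 → ℝ => fun _ : Fin 1 => φ (p 0)) '' r.domain)
      (fun (p : Fin 1 → ℝ) (_ : Fin 1) => ψ (p 0)) := by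
    rw [himg]
    refine IsSemialgebraicMapOn.of_forall hT fun _ => ?_
    exact (isSemialgebraicFunOn_aevalK_div hT Pψ Qψ fun p hp => (hPQψ (p 0) hp).1).congr
      fun p hp => ((hPQψ (p 0) hp).2).symm
  have hGφ : ∀ p ∈ r.domain, (fun _ : Fin 1 => ψ ((fun _ : Fin 1 => φ (p 0)) 0)) = p := by
    intro p hp
    rw [← heq p]
    funext
    exact hψφ _ ((hmem p).1 hp)
  obtain ⟨s, hsd, hsi, hcv⟩ := stub_pushforwardDimOne r φ φ'
    (fun (p : Fin 1 → ℝ) (_ : Fin 1) => ψ (p 0)) hφ hφ'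
    (fun p hp => hder _ ((hmem p).1 hp)) (fun p hp => hne _ ((hmem p).1 hp)) hG hGφ
  have hcont : ContinuousOn φ S := fun x hx => (hder x hx).continuousAt.continuousWithinAt
  have hinj : InjOn φ S := fun x hx y hy h => by rw [← hψφ x hx, ← hψφ y hy, h]
  refine ⟨of s, of_mem_algArcs s (φ '' S) (isOpen_image_of_injOn hS hcont hinj)
    (ordConnected_image hSo hcont) (by rw [hsd, himg]) F hF ?_, ?_⟩
  · intro p' hp'
    rw [hsd] at hp'
    obtain ⟨p, hp, rfl⟩ := hp'
    rw [hsi p hp]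
    exact hFφ p hp
  · exact movesLE_subset_relationsLE 1 ⟨Or.inl (Or.inr hcv),
      sub_mem (of_mem_formalRepLE r le_rfl) (of_mem_formalRepLE s le_rfl)⟩

end Euler

end Summit.KontsevichZagierPeriods.AbelContraction.RealHyperellipticSector

end
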